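import Literature.IUT.LogVolume.RArithmeticDivisors
import Mathlib.NumberTheory.NumberField.InfinitePlace.Ramification
import Mathlib.RingTheory.RamificationInertia.Inertia
import HarnessLib

/-!
# [IUTchIV] Definition 1.9: the pull-back `𝔞|_K` of an `ℝ`-arithmetic divisor and the invariance of the
# normalized degrees, `deg(𝔞|_K) = deg(𝔞)` and `deg_{E|_K}(𝔞|_K) = deg_E(𝔞)` — PROVED

Mochizuki, *Inter-universal Teichmüller theory IV*, §1, Definition 1.9, kurims pp. 21–22, read on the
page: (i) "… Thus, for any finite extension `K` of `F`, we have `deg(𝔞|_K) = deg(𝔞)` — where we write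
`deg(𝔞|_K)` for the normalized degree of the pull-back `𝔞|_K ∈ ADiv_ℝ(K)` [defined in the evident
fashion] of `𝔞` to `K`." (ii) "… Thus, for any finite extension `K` of `F`, we have `deg_{E|_K}(𝔞|_K) =
deg_E(𝔞)` — where we write `E|_K ⊆ 𝕍(K)` for the set of valuations lying over valuations `∈ E`."

The "evident" pull-back (the one for which a prime `v` pulls back to its ideal-theoretic extension
`Σ_{w|v} e_{w|v}·w` and degrees multiply by `[K:F]`): `𝔞|_K := Σ_{w ∈ 𝕍(K)} m_w·c_{v(w)}·w`, where `v(w)`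
is the place of `F` under `w` and `m_w = e_{w|v}` (ramification index) at a nonarchimedean `w`,
`m_w = [K_w : F_v] ∈ {1,2}` at an archimedean `w`. This file DEFINES `Place.below`, the fibres
`placesAbove`, the weights `pullbackWeight`, `ADivisor.pullback`, and PROVES
* `sum_pullbackWeight_mul_degWeight` — the local identities `Σ_{w|v} e_{w|v}·log q_w = [K:F]·log q_v`
  (Mathlib's fundamental identity `Σ e f = [K:F]` + `q_w = q_v^{f_{w|v}}`) and `Σ_{w|v} [K_w:F_v] = [K:F]`
  (Mathlib's count of (un)ramified infinite places over `v`);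
* `degF_pullback : deg_K(𝔞|_K) = [K:F]·deg_F(𝔞)` and **`ndeg_pullback : deg(𝔞|_K) = deg(𝔞)`**;
* `sum_pullbackWeight_mul_placeDegree : Σ_{w|v} m_w·[K_w:ℚ_{v_ℚ}] … ` is NOT needed; instead
  `restrictTo_pullback` (`(𝔞|_K)_{E|_K} = (𝔞_E)|_K`) and `sum_placeDegree_placesAbove`
  (`Σ_{w ∈ E|_K} [K_w:ℚ_{v_ℚ}] = [K:F]·Σ_{v∈E} [F_v:ℚ_{v_ℚ}]`) give **`degE_pullback :
  deg_{E|_K}(𝔞|_K) = deg_E(𝔞)`**.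
[cite: Mochizuki2012, IUTchIV Def. 1.9 (i)(ii) pp. 21–22]
Deliberately NOT here: functoriality in towers `L/K/F`, Galois-invariance, any judgement on Cor. 3.12.
-/

noncomputable section

namespace Literature.IUT.LogVolume

open NumberField IsDedekindDomain Finset
open scoped Classical

variable (F K : Type*) [Field F] [NumberField F] [Field K] [NumberField K] [Algebra F K]

/-! ### Places of `K` over places of `F` -/

/-- The nonarchimedean place of `F` under a nonarchimedean place `w` of `K` (`w ∩ 𝓞_F`).
[cite: Mochizuki2012, IUTchIV Def. 1.9 (ii) p. 22] -/
def finBelow (w : HeightOneSpectrum (𝓞 K)) : HeightOneSpectrum (𝓞 F) :=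
  ⟨w.asIdeal.under (𝓞 F), inferInstance, fun h => w.ne_bot (Ideal.eq_bot_of_comap_eq_bot h)⟩

/-- `w` lies over the place under it. [cite: Mochizuki2012, IUTchIV Def. 1.9 (ii) p. 22] -/
instance liesOver_finBelow (w : HeightOneSpectrum (𝓞 K)) :
    w.asIdeal.LiesOver (finBelow F K w).asIdeal :=
  inferInstanceAs (w.asIdeal.LiesOver (w.asIdeal.under (𝓞 F)))

/-- The place `v(w) ∈ 𝕍(F)` under `w ∈ 𝕍(K)`. [cite: Mochizuki2012, IUTchIV Def. 1.9 (ii) p. 22] -/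
def Place.below : Place K → Place F :=
  Sum.map (fun w => w.comap (algebraMap F K)) (finBelow F K)

/-- `E|_K` for `E = {v}`: the (finite) set of places of `K` lying over `v ∈ 𝕍(F)`.
[cite: Mochizuki2012, IUTchIV Def. 1.9 (ii) p. 22] -/
def placesAbove : Place F → Finset (Place K)
  | Sum.inl v => ((Finset.univ : Finset (InfinitePlace K)).filter
        (fun w => w.comap (algebraMap F K) = v)).map ⟨Sum.inl, Sum.inl_injective⟩
  | Sum.inr v => ((IsDedekindDomain.primesOverFinset v.asIdeal (𝓞 K)).preimage HeightOneSpectrum.asIdeal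
        (fun _ _ _ _ h => HeightOneSpectrum.ext h)).map ⟨Sum.inr, Sum.inr_injective⟩

variable {F K}

/-- `w ∈ {v}|_K ↔ v(w) = v`. [cite: Mochizuki2012, IUTchIV Def. 1.9 (ii) p. 22] -/
theorem mem_placesAbove_iff (v : Place F) (w : Place K) :
    w ∈ placesAbove F K v ↔ Place.below F K w = v := by
  rcases v with v | v <;> rcases w with w | w
  · simp [placesAbove, Place.below]
  · simp [placesAbove, Place.below]
  · simp [placesAbove, Place.below]
  · simp only [placesAbove, Place.below, Finset.mem_map, Finset.mem_preimage,
      Function.Embedding.coeFn_mk, Sum.inr.injEq, exists_eq_right, Sum.map_inr]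
    rw [IsDedekindDomain.mem_primesOverFinset_iff v.ne_bot]
    constructor
    · rintro ⟨_, hover⟩
      exact HeightOneSpectrum.ext (hover.over).symm
    · intro h
      refine ⟨w.isPrime, ⟨?_⟩⟩
      rw [← h]; rfl

/-- Every place of `K` lies in the fibre of the place under it. [cite: Mochizuki2012, IUTchIV Def. 1.9 (ii) p. 22] -/
theorem mem_placesAbove_below (w : Place K) : w ∈ placesAbove F K (Place.below F K w) :=
  (mem_placesAbove_iff _ w).mpr rfl

/-- Distinct places have disjoint fibres. [cite: Mochizuki2012, IUTchIV Def. 1.9 (ii) p. 22] -/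
theorem pairwiseDisjoint_placesAbove (S : Set (Place F)) :
    S.PairwiseDisjoint (placesAbove F K) := by
  intro v _ v' _ hne
  refine Finset.disjoint_left.mpr fun w hw hw' => hne ?_
  rw [mem_placesAbove_iff] at hw hw'
  exact hw.symm.trans hw'

/-- A prime of `𝓞_K` in the factorisation of `v·𝓞_K` lies over `v`. [cite: Mochizuki2012, IUTchIV Def. 1.9 (ii) p. 22] -/
theorem finBelow_eq_of_mem {v : HeightOneSpectrum (𝓞 F)} {w : HeightOneSpectrum (𝓞 K)}
    (hw : w ∈ (IsDedekindDomain.primesOverFinset v.asIdeal (𝓞 K)).preimage HeightOneSpectrum.asIdeal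
      (fun _ _ _ _ h => HeightOneSpectrum.ext h)) : finBelow F K w = v := by
  have := (mem_placesAbove_iff (F := F) (K := K) (Sum.inr v) (Sum.inr w)).mp
    (by rw [placesAbove, Finset.mem_map]; exact ⟨w, hw, rfl⟩)
  simpa [Place.below] using this

/-! ### The weights `m_w` and the pull-back -/

variable (F K)

/-- The pull-back multiplicities: `m_w = e_{w|v}` (ramification index) at a nonarchimedean `w`,
`m_w = [K_w : F_v]` (`1` if `w/v` is unramified, i.e. of the same type, `2` if `v` is real and `w`
complex) at an archimedean `w`. [cite: Mochizuki2012, IUTchIV Def. 1.9 (i) p. 22] -/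
def pullbackWeight : Place K → ℕ
  | Sum.inl w => if w.IsUnramified F then 1 else 2
  | Sum.inr w => Ideal.ramificationIdx' (finBelow F K w).asIdeal w.asIdeal

namespace ADivisor

/-- **The pull-back** `𝔞|_K := Σ_{w ∈ 𝕍(K)} m_w·c_{v(w)}·w ∈ ADiv_ℝ(K)` of `𝔞 = Σ_v c_v·v ∈ ADiv_ℝ(F)`.
[cite: Mochizuki2012, IUTchIV Def. 1.9 (i) p. 22] -/
def pullback (a : ADivisor F) : ADivisor K :=
  Finsupp.onFinset (a.support.biUnion (placesAbove F K))
    (fun w => (pullbackWeight F K w : ℝ) * a (Place.below F K w)) fun w hw => by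
      refine Finset.mem_biUnion.mpr ⟨Place.below F K w, ?_, mem_placesAbove_below w⟩
      rw [Finsupp.mem_support_iff]
      intro h
      exact hw (by rw [h, mul_zero])

variable {F K}

/-- Coefficients of the pull-back: `c_w(𝔞|_K) = m_w·c_{v(w)}`. [cite: Mochizuki2012, IUTchIV Def. 1.9 (i) p. 22] -/
@[simp] theorem pullback_apply (a : ADivisor F) (w : Place K) :
    a.pullback F K w = pullbackWeight F K w * a (Place.below F K w) := rfl

/-- The pull-back is additive. [cite: Mochizuki2012, IUTchIV Def. 1.9 (i) p. 22] -/
theorem pullback_add (a b : ADivisor F) : (a + b).pullback F K = a.pullback F K + b.pullback F K := by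
  ext w; simp [mul_add]

/-- `(𝔞|_K)_{E|_K} = (𝔞_E)|_K`. [cite: Mochizuki2012, IUTchIV Def. 1.9 (ii) p. 22] -/
theorem restrictTo_pullback (E : Finset (Place F)) (a : ADivisor F) :
    (a.pullback F K).restrictTo (E.biUnion (placesAbove F K)) = (a.restrictTo E).pullback F K := by
  ext w
  simp only [restrictTo_apply, pullback_apply, Finset.mem_biUnion, mem_placesAbove_iff]
  by_cases h : Place.below F K w ∈ E
  · rw [if_pos ⟨_, h, rfl⟩, if_pos h]
  · rw [if_neg (by rintro ⟨v, hv, hvw⟩; exact h (hvw ▸ hv)), if_neg h, mul_zero]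

end ADivisor

variable {F K}

/-! ### The local identities -/

/-- `q_w = q_v^{f_{w|v}}`, hence `log q_w = f_{w|v}·log q_v`. [cite: Mochizuki2012, IUTchIV Def. 1.9 p. 21] -/
theorem logNorm_eq_inertiaDeg_mul (w : HeightOneSpectrum (𝓞 K)) :
    logNorm K w = (Ideal.inertiaDeg' (finBelow F K w).asIdeal w.asIdeal : ℝ) * logNorm F (finBelow F K w) := by
  haveI : (finBelow F K w).asIdeal.IsMaximal := (finBelow F K w).isMaximal
  haveI : w.asIdeal.IsMaximal := w.isMaximal
  rw [Ideal.inertiaDeg'_eq_inertiaDeg, logNorm, logNorm,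
    ← Ideal.absNorm_pow_inertiaDeg (finBelow F K w).asIdeal w.asIdeal, Nat.cast_pow, Real.log_pow]

/-- **`Σ_{w | v} e_{w|v}·log q_w = [K:F]·log q_v`** (nonarchimedean `v`): the fundamental identity
`Σ_{w|v} e_{w|v} f_{w|v} = [K:F]`. [cite: Mochizuki2012, IUTchIV Def. 1.9 (i) p. 22] -/
theorem sum_pullbackWeight_mul_degWeight_inr (v : HeightOneSpectrum (𝓞 F)) :
    ∑ w ∈ placesAbove F K (Sum.inr v), (pullbackWeight F K w : ℝ) * degWeight K w =
      Module.finrank F K * degWeight F (Sum.inr v) := by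
  haveI : v.asIdeal.IsMaximal := v.isMaximal
  have key := Ideal.sum_ramification_inertia (R := 𝓞 F) (𝓞 K) F K (p := v.asIdeal) v.ne_bot
  rw [placesAbove, Finset.sum_map, degWeight_inr]
  calc ∑ w ∈ (IsDedekindDomain.primesOverFinset v.asIdeal (𝓞 K)).preimage HeightOneSpectrum.asIdeal _,
        (pullbackWeight F K (Sum.inr w) : ℝ) * degWeight K (Sum.inr w)
      = ∑ w ∈ (IsDedekindDomain.primesOverFinset v.asIdeal (𝓞 K)).preimage HeightOneSpectrum.asIdeal
          (fun _ _ _ _ h => HeightOneSpectrum.ext h),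
          ((Ideal.ramificationIdx' v.asIdeal w.asIdeal * Ideal.inertiaDeg' v.asIdeal w.asIdeal : ℕ) : ℝ)
            * logNorm F v := by
        refine Finset.sum_congr rfl fun w hw => ?_
        simp only [pullbackWeight, degWeight_inr]
        rw [logNorm_eq_inertiaDeg_mul (F := F) w, finBelow_eq_of_mem hw]
        push_cast
        ring
    _ = ((∑ P ∈ IsDedekindDomain.primesOverFinset v.asIdeal (𝓞 K),
          Ideal.ramificationIdx' v.asIdeal P * Ideal.inertiaDeg' v.asIdeal P : ℕ) : ℝ) * logNorm F v := by
        rw [← Finset.sum_mul]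
        congr 1
        push_cast
        refine Finset.sum_preimage HeightOneSpectrum.asIdeal (IsDedekindDomain.primesOverFinset v.asIdeal (𝓞 K)) _
          (fun P => ((Ideal.ramificationIdx' v.asIdeal P : ℝ) * (Ideal.inertiaDeg' v.asIdeal P : ℝ))) ?_
        intro P hP hnot
        exfalso
        rw [IsDedekindDomain.mem_primesOverFinset_iff v.ne_bot] at hP
        exact hnot ⟨⟨P, hP.1, Ideal.ne_bot_of_mem_primesOver v.ne_bot hP⟩, rfl⟩
    _ = Module.finrank F K * logNorm F v := by rw [key]

omit [NumberField F] [NumberField K] in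
/-- `w` lies over `v` (as absolute values) iff `v` is the restriction of `w`.
[cite: Mochizuki2012, IUTchIV Def. 1.9 (ii) p. 22] -/
theorem liesOver_iff_comap_eq (w : InfinitePlace K) (v : InfinitePlace F) :
    w.1.LiesOver v.1 ↔ w.comap (algebraMap F K) = v := by
  constructor
  · intro h
    exact InfinitePlace.LiesOver.comap_eq w v
  · intro h
    exact ⟨congrArg Subtype.val h⟩

/-- **`Σ_{w | v} [K_w : F_v] = [K:F]`** (archimedean `v`): Mathlib's count
`#{unramified w|v} + 2·#{ramified w|v} = [K:F]`. [cite: Mochizuki2012, IUTchIV Def. 1.9 (i) p. 22] -/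
theorem sum_pullbackWeight_mul_degWeight_inl (v : InfinitePlace F) :
    ∑ w ∈ placesAbove F K (Sum.inl v), (pullbackWeight F K w : ℝ) * degWeight K w =
      Module.finrank F K * degWeight F (Sum.inl v) := by
  rw [placesAbove, Finset.sum_map, degWeight_inl, mul_one]
  simp only [Function.Embedding.coeFn_mk, degWeight_inl, mul_one, pullbackWeight, Nat.cast_ite,
    Nat.cast_one, Nat.cast_ofNat]
  have hcount := InfinitePlace.unramifedPlacesOver_ncard_add_eq_finrank K v
  -- rewrite the two `ncard`s as cardinalities of filters of `univ`
  have hU : (v.unramifiedPlacesOver K).ncard =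
      ((Finset.univ : Finset (InfinitePlace K)).filter
        (fun w => w.comap (algebraMap F K) = v ∧ w.IsUnramified F)).card := by
    rw [Set.ncard_eq_toFinset_card']
    congr 1
    ext w
    simp [InfinitePlace.unramifiedPlacesOver, liesOver_iff_comap_eq]
  have hR : (v.ramifiedPlacesOver K).ncard =
      ((Finset.univ : Finset (InfinitePlace K)).filter
        (fun w => w.comap (algebraMap F K) = v ∧ ¬ w.IsUnramified F)).card := by
    rw [Set.ncard_eq_toFinset_card']
    congr 1
    ext w
    simp [InfinitePlace.ramifiedPlacesOver, liesOver_iff_comap_eq, InfinitePlace.IsRamified]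
  rw [hU, hR] at hcount
  rw [Finset.sum_ite, Finset.filter_filter, Finset.filter_filter, Finset.sum_const, Finset.sum_const,
    nsmul_eq_mul, nsmul_eq_mul, mul_one]
  have := congrArg (fun n : ℕ => (n : ℝ)) hcount
  push_cast at this
  linarith

/-- The local identity at every place: `Σ_{w ∈ {v}|_K} m_w·deg_K(w) = [K:F]·deg_F(v)`.
[cite: Mochizuki2012, IUTchIV Def. 1.9 (i) p. 22] -/
theorem sum_pullbackWeight_mul_degWeight (v : Place F) :
    ∑ w ∈ placesAbove F K v, (pullbackWeight F K w : ℝ) * degWeight K w =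
      Module.finrank F K * degWeight F v := by
  rcases v with v | v
  · exact sum_pullbackWeight_mul_degWeight_inl v
  · exact sum_pullbackWeight_mul_degWeight_inr (F := F) (K := K) v

/-! ### Invariance of the normalized degrees -/

/-- `deg_K(𝔞|_K) = [K:F]·deg_F(𝔞)`. [cite: Mochizuki2012, IUTchIV Def. 1.9 (i) p. 22] -/
theorem degF_pullback (a : ADivisor F) :
    degF K (a.pullback F K) = Module.finrank F K * degF F a := by
  rw [degF_apply, ADivisor.pullback, Finsupp.onFinset_sum _ (fun w => by rw [zero_mul]),
    Finset.sum_biUnion (pairwiseDisjoint_placesAbove (K := K) _), degF_apply, Finsupp.sum,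
    Finset.mul_sum]
  refine Finset.sum_congr rfl fun v _ => ?_
  calc ∑ w ∈ placesAbove F K v, (pullbackWeight F K w : ℝ) * a (Place.below F K w) * degWeight K w
      = a v * ∑ w ∈ placesAbove F K v, (pullbackWeight F K w : ℝ) * degWeight K w := by
        rw [Finset.mul_sum]
        refine Finset.sum_congr rfl fun w hw => ?_
        rw [(mem_placesAbove_iff v w).mp hw]
        ring
    _ = Module.finrank F K * (a v * degWeight F v) := by
        rw [sum_pullbackWeight_mul_degWeight]; ring

/-- The tower law of absolute degrees: `[K:ℚ] = [K:F]·[F:ℚ]`. [cite: Mochizuki2012, IUTchIV Def. 1.9 (i) p. 22] -/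
theorem finrank_rat_eq_mul : (Module.finrank ℚ K : ℝ) = Module.finrank F K * Module.finrank ℚ F := by
  rw [mul_comm]
  exact_mod_cast (Module.finrank_mul_finrank ℚ F K).symm

/-- **`deg(𝔞|_K) = deg(𝔞)`**: the normalized degree is invariant under pull-back.
[cite: Mochizuki2012, IUTchIV Def. 1.9 (i) p. 22] -/
theorem ndeg_pullback (a : ADivisor F) : ndeg K (a.pullback F K) = ndeg F a := by
  have hF : (0 : ℝ) < Module.finrank ℚ F := by exact_mod_cast Module.finrank_pos
  have hKF : (0 : ℝ) < Module.finrank F K := by exact_mod_cast Module.finrank_pos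
  rw [ndeg_apply, ndeg_apply, degF_pullback, finrank_rat_eq_mul (F := F) (K := K)]
  field_simp

/-- `Σ_{w ∈ {v}|_K} [K_w : ℚ_{v_ℚ}] = [K:F]·[F_v : ℚ_{v_ℚ}]`: local degrees in the fibre
(`[K_w:ℚ_{v_ℚ}] = m_w·f_{w|v}·[F_v:ℚ_{v_ℚ}]`-bookkeeping, via the same two Mathlib counts).
[cite: Mochizuki2012, IUTchIV Def. 1.9 (ii) p. 22] -/
theorem sum_placeDegree_placesAbove (v : Place F) :
    ∑ w ∈ placesAbove F K v, (placeDegree K w : ℝ) = Module.finrank F K * placeDegree F v := by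
  classical
  rcases v with v | v
  · -- archimedean: `[K_w:ℝ] = [K_w:F_v]·[F_v:ℝ]`, i.e. `mult w = m_w · mult v`
    have h := sum_pullbackWeight_mul_degWeight_inl (F := F) (K := K) v
    rw [degWeight_inl, mul_one, placesAbove, Finset.sum_map] at h
    simp only [Function.Embedding.coeFn_mk, degWeight_inl, mul_one] at h
    rw [placesAbove, Finset.sum_map]
    simp only [Function.Embedding.coeFn_mk, placeDegree, Sum.elim_inl]
    calc ∑ x ∈ Finset.univ.filter (fun w : InfinitePlace K => w.comap (algebraMap F K) = v), (x.mult : ℝ)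
        = ∑ x ∈ Finset.univ.filter (fun w : InfinitePlace K => w.comap (algebraMap F K) = v),
            (pullbackWeight F K (Sum.inl x) : ℝ) * (v.mult : ℝ) := by
          refine Finset.sum_congr rfl fun w hw => ?_
          have hwv : w.comap (algebraMap F K) = v := (Finset.mem_filter.mp hw).2
          simp only [pullbackWeight]
          by_cases hu : w.IsUnramified F
          · rw [if_pos hu]
            have : v.mult = w.mult := by rw [← hwv]; exact hu
            simp [this]
          · rw [if_neg hu]
            -- ramified: `v` real (`mult v = 1`), `w` complex (`mult w = 2`)
            have hlt : (w.comap (algebraMap F K)).mult < w.mult :=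
              lt_of_le_of_ne (InfinitePlace.mult_comap_le _ _) hu
            have hw2 : w.mult ≤ 2 := by unfold InfinitePlace.mult; split_ifs <;> norm_num
            have hv1 : 1 ≤ (w.comap (algebraMap F K)).mult := InfinitePlace.mult_pos
            have hv : v.mult = 1 := by rw [← hwv]; omega
            have hw : w.mult = 2 := by omega
            simp [hv, hw]
      _ = (∑ x ∈ Finset.univ.filter (fun w : InfinitePlace K => w.comap (algebraMap F K) = v),
            (pullbackWeight F K (Sum.inl x) : ℝ)) * (v.mult : ℝ) := by rw [Finset.sum_mul]
      _ = Module.finrank F K * (v.mult : ℝ) := by rw [h]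
  · -- nonarchimedean: `n_w = e_{w|p} f_{w|p} = (e_{v|p} e_{w|v})(f_{v|p} f_{w|v}) = n_v · e_{w|v} f_{w|v}`
    -- (multiplicativity in the tower `ℤ ⊆ 𝓞_F ⊆ 𝓞_K`), then `Σ_{w|v} e_{w|v} f_{w|v} = [K:F]`.
    haveI : v.asIdeal.IsMaximal := v.isMaximal
    have key := Ideal.sum_ramification_inertia (R := 𝓞 F) (𝓞 K) F K (p := v.asIdeal) v.ne_bot
    rw [placesAbove, Finset.sum_map]
    simp only [Function.Embedding.coeFn_mk, placeDegree, Sum.elim_inr]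
    have hterm : ∀ w ∈ (IsDedekindDomain.primesOverFinset v.asIdeal (𝓞 K)).preimage HeightOneSpectrum.asIdeal
        (fun _ _ _ _ h => HeightOneSpectrum.ext h),
        (localDegree K w : ℝ) = localDegree F v *
          ((Ideal.ramificationIdx' v.asIdeal w.asIdeal * Ideal.inertiaDeg' v.asIdeal w.asIdeal : ℕ) : ℝ) := by
      intro w hw
      have hvw : finBelow F K w = v := finBelow_eq_of_mem hw
      subst hvw
      have hchar : residueChar K w = residueChar F (finBelow F K w) := by
        unfold residueChar
        rw [show w.asIdeal.under ℤ = ((finBelow F K w).asIdeal).under ℤ from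
          (Ideal.under_under (A := ℤ) (B := 𝓞 F) w.asIdeal).symm]
      haveI : (finBelow F K w).asIdeal.IsMaximal := (finBelow F K w).isMaximal
      haveI : w.asIdeal.IsMaximal := w.isMaximal
      have hpr : (residueChar F (finBelow F K w)).Prime := residueChar_prime F _
      haveI : (Ideal.span {(residueChar F (finBelow F K w) : ℤ)}).IsMaximal :=
        Ideal.IsPrime.isMaximal ((Ideal.span_singleton_prime (by exact_mod_cast hpr.ne_zero)).mpr
          (Nat.prime_iff_prime_int.mp hpr)) (by simp [hpr.ne_zero])
      unfold localDegree ramIdx resDeg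
      rw [hchar, Ideal.ramificationIdx'_algebra_tower' (Ideal.span {(residueChar F (finBelow F K w) : ℤ)})
          (finBelow F K w).asIdeal w.asIdeal,
        Ideal.inertiaDeg'_algebra_tower (Ideal.span {(residueChar F (finBelow F K w) : ℤ)})
          (finBelow F K w).asIdeal w.asIdeal]
      push_cast
      ring
    rw [Finset.sum_congr rfl hterm, ← Finset.mul_sum, mul_comm]
    congr 1
    rw [← key]
    push_cast
    refine Finset.sum_preimage HeightOneSpectrum.asIdeal (IsDedekindDomain.primesOverFinset v.asIdeal (𝓞 K)) _
      (fun P => ((Ideal.ramificationIdx' v.asIdeal P : ℝ) * (Ideal.inertiaDeg' v.asIdeal P : ℝ))) ?_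
    intro P hP hnot
    exfalso
    rw [IsDedekindDomain.mem_primesOverFinset_iff v.ne_bot] at hP
    exact hnot ⟨⟨P, hP.1, Ideal.ne_bot_of_mem_primesOver v.ne_bot hP⟩, rfl⟩

/-- **`deg_{E|_K}(𝔞|_K) = deg_E(𝔞)`**: the normalized `E`-degree is invariant under pull-back.
[cite: Mochizuki2012, IUTchIV Def. 1.9 (ii) p. 22] -/
theorem degE_pullback (E : Finset (Place F)) (hE : E.Nonempty) (a : ADivisor F) :
    degE K (E.biUnion (placesAbove F K)) (a.pullback F K) = degE F E a := by
  have hKF : (0 : ℝ) < Module.finrank F K := by exact_mod_cast Module.finrank_pos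
  have hE' := sum_placeDegree_pos F hE
  rw [degE, degE, ADivisor.restrictTo_pullback (F := F) (K := K) E a, degF_pullback,
    Finset.sum_biUnion (pairwiseDisjoint_placesAbove (K := K) _),
    Finset.sum_congr rfl (fun v _ => sum_placeDegree_placesAbove (F := F) (K := K) v),
    ← Finset.mul_sum]
  field_simp

end Literature.IUT.LogVolume
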